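import Literature.NumberTheory.EllipticCurves.Tamagawa
import Literature.NumberTheory.Automorphic.AdicCompletionCompact
import HarnessLib

/-!
# Finiteness of `E(K_v)/E₀(K_v)` and positivity of the Tamagawa product

Sibling proof file of `Literature.NumberTheory.EllipticCurves.Tamagawa` (D-0014: that file states
cited results as named facts `def X : Prop`). It **discharges** the named fact
`WeierstrassCurve.tamagawaProduct_pos` (`0 < ∏ᶠ_v c_v` for an elliptic curve over a number
field): every local Tamagawa number `c_v = [E(K_v) : E₀(K_v)]` (Mathlib-style `AddSubgroup.index`
of `WeierstrassCurve.goodReductionSubgroup` on the `O_v`-minimal model, junk value `0` for an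
infinite index) is non-zero, i.e. `E₀(K_v)` has finite index in `E(K_v)` — Silverman,
*The Arithmetic of Elliptic Curves*, 2nd ed., Cor. VII.6.2 (PDF p. 177).

## The proof (Silverman, *AEC*, Exercise 7.6, PDF p. 181: "the mere finiteness of `E(K)/E₀(K)`
## can be proven by an easy compactness argument")

Let `M` be an `O_v`-integral Weierstrass equation of an elliptic curve over the completion `K_v`
(with `|·| = Valued.v`, `O_v = {|x| ≤ 1}`), and let `E₀ ⊆ M(K_v)` be the subgroup generated by
the points with nonsingular reduction; by definition it contains `𝒪` and every point `(x, y)`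
with `x ∉ O_v` (these reduce to `Õ`).

1. *(the group law near the diagonal, `WeierstrassCurve.Affine.one_lt_valuation_addX_of_near`)*
   For integral points `P = (x₁, y₁) ≠ Q = (x₂, y₂)` of `M` with
   `|x₂ - x₁|, |y₂ - y₁| < δ ≤ max (|F_x(P)|, |F_y(P)|)` (`F_x, F_y` the partial derivatives of
   the Weierstrass polynomial), the `x`-coordinate of `Q - P` has `|x(Q - P)| > 1`: by the
   exact Taylor expansion `F_y(P)Δy + F_x(P)Δx + Δy² + a₁ΔxΔy - (3x₁ + a₂)Δx² - Δx³ = 0` the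
   chord (or tangent) through `Q` and `-P` has slope `λ` with `|λ| > 1`, and then
   `|λ² + a₁λ - a₂ - x₁ - x₂| = |λ|² > 1`. So `Q - P ∈ E₀`. (This is the quantitative form of
   "translation is continuous and `E₀(K)` is open", parts (b), (c) of Exercise 7.6.)
2. *(compactness, `WeierstrassCurve.exists_finset_integralPoints_near`)* the integral points form
   a closed subset of the compact `O_v × O_v` (part (a),(b) of Exercise 7.6; `O_v` is compact for a
   number field: `Literature.NumberTheory.Automorphic.compactSpace_adicCompletionIntegers'`, Weil, *BNT*, Ch. I §4),
   so finitely many of the neighbourhoods of step 1 cover them.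
3. Hence every point of `M(K_v)` is congruent modulo `E₀` to `𝒪` or to one of finitely many
   integral points: `E(K_v)/E₀(K_v)` is finite
   (`WeierstrassCurve.finite_quotient_goodReductionSubgroup`, part (d) of Exercise 7.6), the
   index is non-zero (`WeierstrassCurve.localTamagawaNumber_ne_zero_of_compactSpace`,
   `WeierstrassCurve.localTamagawaNumber_baseChange_ne_zero`), and the `finprod` of the
   positive local factors is positive (`WeierstrassCurve.tamagawaProduct_pos_holds`).

No case analysis of reduction types (Tate's algorithm, Thm. VII.6.1) and no Néron model is used;
accordingly nothing is said about the *value* of `c_v`.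

Generic valuation lemmas are in `namespace Literature`; statements about Weierstrass equations are
deliberate dot-notation extensions of Mathlib's `namespace WeierstrassCurve` /
`WeierstrassCurve.Affine`, like the fact they discharge. `open scoped Classical` and no
`[DecidableEq]` variables, as in `Tamagawa.lean` (group-wide rule of T-ELLARITH).

## References

* J. H. Silverman, *The Arithmetic of Elliptic Curves*, 2nd ed., GTM 106, Springer 2009:
  VII.2 (reduction, `E₀`, `E₁`), Cor. VII.6.2 (PDF p. 177) and Exercise 7.6 (PDF p. 181).
  [SilvermanAEC2009]
* A. Weil, *Basic Number Theory* (1967), Ch. I §4 (compactness of the local integers).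
-/

noncomputable section

open scoped Classical Topology

/-! ### Generic valuation lemmas -/

namespace Literature.NumberTheory.EllipticCurves

/-- In a valued field, the open ball `{b | |b - a| < |c|}` (`c` with `|c| ≠ 0`) is a
neighbourhood of `a` (Mathlib's `Valued.mem_nhds`, restated with a radius of the form `|c|`).
[folklore] -/
theorem valued_ball_mem_nhds {L : Type*} [Field L] {Γ₀ : Type*} [LinearOrderedCommGroupWithZero Γ₀]
    [Valued L Γ₀] (a : L) {c : L} (hc : Valued.v c ≠ 0) :
    {b : L | Valued.v (b - a) < Valued.v c} ∈ 𝓝 a := by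
  rw [Valued.mem_nhds]
  refine ⟨Units.mk0 (Valued.v.restrict c) ?_, fun b hb => ?_⟩
  · simpa only [ne_eq, Valuation.restrict_eq_zero_iff] using hc
  · simpa only [Set.mem_setOf_eq, Units.val_mk0, Valuation.restrict_lt_iff] using hb

end Literature.NumberTheory.EllipticCurves

namespace WeierstrassCurve

namespace Affine

/-! ### The chord–tangent law near the diagonal (valuation estimates) -/

section Valuation

variable {F : Type*} [Field F] {Γ₀ : Type*} [LinearOrderedCommGroupWithZero Γ₀]
  (w : Valuation F Γ₀) {W : Affine F}

/-- On an integral Weierstrass equation (`|aᵢ| ≤ 1`), a point with integral `x`-coordinate has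
integral `y`-coordinate: otherwise `|y² + a₁xy + a₃y| = |y|² > 1 ≥ |x³ + a₂x² + a₄x + a₆|`.
(Silverman, *AEC*, VII.2, proof of Prop. 2.1: a point is integral iff `x` is.) [folklore] -/
theorem valuation_y_le_one (ha₁ : w W.a₁ ≤ 1) (ha₂ : w W.a₂ ≤ 1) (ha₃ : w W.a₃ ≤ 1)
    (ha₄ : w W.a₄ ≤ 1) (ha₆ : w W.a₆ ≤ 1) {x y : F} (h : W.Equation x y) (hx : w x ≤ 1) :
    w y ≤ 1 := by
  by_contra hy
  rw [not_le] at hy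
  rw [equation_iff] at h
  have hy0 : 0 < w y := lt_trans zero_lt_one hy
  have hy2 : w y < w y * w y := by simpa only [mul_one] using mul_lt_mul_of_pos_left hy hy0
  -- the right-hand side is integral
  have hR : w (x ^ 3 + W.a₂ * x ^ 2 + W.a₄ * x + W.a₆) ≤ 1 := by
    refine w.map_add_le (w.map_add_le (w.map_add_le ?_ ?_) ?_) ha₆
    · rw [map_pow]; exact pow_le_one' hx 3
    · rw [map_mul, map_pow]; exact mul_le_one' ha₂ (pow_le_one' hx 2)
    · rw [map_mul]; exact mul_le_one' ha₄ hx
  -- the left-hand side has valuation `|y|² > 1`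
  have hlow : w (W.a₁ * x * y + W.a₃ * y) < w (y ^ 2) := by
    rw [map_pow, sq]
    refine w.map_add_lt ?_ ?_
    · rw [map_mul, map_mul]
      exact lt_of_le_of_lt (mul_le_of_le_one_left' (mul_le_one' ha₁ hx)) hy2
    · rw [map_mul]
      exact lt_of_le_of_lt (mul_le_of_le_one_left' ha₃) hy2
  have hL : w (y ^ 2 + W.a₁ * x * y + W.a₃ * y) = w y * w y := by
    rw [add_assoc, Valuation.map_add_eq_of_lt_left _ hlow, map_pow, sq]
  rw [h] at hL
  rw [hL] at hR
  exact absurd (one_lt_mul'' hy hy) (not_lt.mpr hR)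

/-- If the line used to add two integral points of an integral Weierstrass equation has slope
`λ` with `|λ| > 1`, then the sum has `|x| = |λ² + a₁λ - a₂ - x₁ - x₂| = |λ|² > 1`, i.e. it is a
non-integral point (it reduces to `Õ`). Silverman, *AEC*, III.2.3 (addition formula) with VII.2.
[folklore] -/
theorem one_lt_valuation_addX (ha₁ : w W.a₁ ≤ 1) (ha₂ : w W.a₂ ≤ 1) {x₁ x₂ : F} (hx₁ : w x₁ ≤ 1)
    (hx₂ : w x₂ ≤ 1) {ℓ : F} (hℓ : 1 < w ℓ) : 1 < w (W.addX x₁ x₂ ℓ) := by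
  have hℓ0 : 0 < w ℓ := lt_trans zero_lt_one hℓ
  have hℓ2 : w ℓ < w ℓ * w ℓ := by simpa only [mul_one] using mul_lt_mul_of_pos_left hℓ hℓ0
  have hrest : w (W.a₁ * ℓ - W.a₂ - x₁ - x₂) < w (ℓ ^ 2) := by
    rw [map_pow, sq]
    refine w.map_sub_lt (w.map_sub_lt (w.map_sub_lt ?_ ?_) ?_) ?_
    · rw [map_mul]; exact lt_of_le_of_lt (mul_le_of_le_one_left' ha₁) hℓ2
    · exact lt_of_le_of_lt ha₂ (lt_trans hℓ hℓ2)
    · exact lt_of_le_of_lt hx₁ (lt_trans hℓ hℓ2)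
    · exact lt_of_le_of_lt hx₂ (lt_trans hℓ hℓ2)
  have e : W.addX x₁ x₂ ℓ = ℓ ^ 2 + (W.a₁ * ℓ - W.a₂ - x₁ - x₂) := by rw [addX]; ring
  rw [e, Valuation.map_add_eq_of_lt_left _ hrest, map_pow, sq]
  exact lt_trans hℓ hℓ2

/-- **The group law near the diagonal** (the computational content of "translation is continuous
and `E₀(K)` is open", Silverman, *AEC*, Exercise 7.6 (b),(c), PDF p. 181). Let `W` be a
Weierstrass equation with `|a₁|, |a₂| ≤ 1`, and let `P = (x₁, y₁)`, `Q = (x₂, y₂)` be distinct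
points with `|x₁|, |x₂| ≤ 1`. Put `F_x(P) = a₁y₁ - (3x₁² + 2a₂x₁ + a₄)`,
`F_y(P) = 2y₁ + a₁x₁ + a₃`. If `|x₂ - x₁| < δ`, `|y₂ - y₁| < δ` for some
`δ ≤ max (|F_x(P)|, |F_y(P)|)`, then the `x`-coordinate of `Q - P = Q + (-P)` (Mathlib's `addX`
at the slope of the line through `Q` and `-P`) has valuation `> 1`.

Proof: subtracting the two Weierstrass equations gives the exact expansion
`F_y(P)Δy + F_x(P)Δx + Δy² + a₁ΔxΔy - (3x₁ + a₂)Δx² - Δx³ = 0`. If `x₂ ≠ x₁` the slope is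
`λ = s/Δx` with `s = Δy + F_y(P)`; were `|s| ≤ |Δx|`, the expansion (in which `F_y(P)Δy + Δy²`
becomes `sΔy`) would force `|F_x(P)| < δ` and `|F_y(P)| = |s - Δy| < δ`, a contradiction; so
`|λ| > 1`. If `x₂ = x₁` then `Q = -P ≠ P`, `|F_y(P)| = |Δy| < δ ≤ |F_x(P)|`, and the tangent
slope at `Q` is `-(F_x(P) + a₁Δy)/Δy`, of valuation `|F_x(P)|/|Δy| > 1`. Conclude by
`one_lt_valuation_addX`. [cite: SilvermanAEC2009, Exercise 7.6 (b),(c) (PDF p. 181)] -/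
theorem one_lt_valuation_addX_of_near (ha₁ : w W.a₁ ≤ 1) (ha₂ : w W.a₂ ≤ 1) {x₁ y₁ x₂ y₂ : F}
    (h₁ : W.Equation x₁ y₁) (h₂ : W.Equation x₂ y₂) (hx₁ : w x₁ ≤ 1) (hx₂ : w x₂ ≤ 1) {δ : Γ₀}
    (hδ : δ ≤ max (w (W.a₁ * y₁ - (3 * x₁ ^ 2 + 2 * W.a₂ * x₁ + W.a₄)))
      (w (2 * y₁ + W.a₁ * x₁ + W.a₃)))
    (hdx : w (x₂ - x₁) < δ) (hdy : w (y₂ - y₁) < δ) (hne : ¬(x₂ = x₁ ∧ y₂ = y₁)) :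
    1 < w (W.addX x₂ x₁ (W.slope x₂ x₁ y₂ (W.negY x₁ y₁))) := by
  set Fx := W.a₁ * y₁ - (3 * x₁ ^ 2 + 2 * W.a₂ * x₁ + W.a₄) with hFx
  set Fy := 2 * y₁ + W.a₁ * x₁ + W.a₃ with hFy
  refine one_lt_valuation_addX w ha₁ ha₂ hx₂ hx₁ ?_
  by_cases hx : x₂ = x₁
  · -- vertical case: `Q = -P`, the sum `Q + (-P)` is the doubling of `Q`
    have hy₂ : y₂ = W.negY x₁ y₁ :=
      (Y_eq_of_X_eq h₂ h₁ hx).resolve_left fun h => hne ⟨hx, h⟩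
    have hy' : y₂ ≠ W.negY x₁ (W.negY x₁ y₁) := by
      rw [negY_negY]
      exact fun h => hne ⟨hx, h⟩
    have hnn : W.negY x₂ y₂ = y₁ := by rw [hx, hy₂, negY_negY]
    have hdy' : y₂ - y₁ = -Fy := by rw [hy₂, hFy, negY]; ring
    have hFy_lt : w Fy < δ := by rwa [hdy', Valuation.map_neg] at hdy
    have hFx_ge : δ ≤ w Fx :=
      (le_max_iff.mp hδ).resolve_right fun h => (not_le.mpr hFy_lt) h
    have hdy0 : y₂ - y₁ ≠ 0 := fun h => hne ⟨hx, sub_eq_zero.mp h⟩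
    have hnum : 3 * x₂ ^ 2 + 2 * W.a₂ * x₂ + W.a₄ - W.a₁ * y₂ = -(Fx + W.a₁ * (y₂ - y₁)) := by
      rw [hFx, hx]; ring
    have hwnum : w (3 * x₂ ^ 2 + 2 * W.a₂ * x₂ + W.a₄ - W.a₁ * y₂) = w Fx := by
      rw [hnum, Valuation.map_neg, Valuation.map_add_eq_of_lt_left]
      rw [map_mul]
      exact lt_of_le_of_lt (mul_le_of_le_one_left' ha₁) (lt_of_lt_of_le hdy hFx_ge)
    rw [slope_of_Y_ne hx hy', hnn, map_div₀, one_lt_div₀ ((Valuation.pos_iff _).mpr hdy0), hwnum]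
    exact lt_of_lt_of_le hdy hFx_ge
  · -- chord case
    rw [slope_of_X_ne hx]
    set s := y₂ - W.negY x₁ y₁ with hs_def
    have hs : s = (y₂ - y₁) + Fy := by rw [hs_def, hFy, negY]; ring
    have hdx0 : x₂ - x₁ ≠ 0 := sub_ne_zero.mpr hx
    have hdxpos : 0 < w (x₂ - x₁) := (Valuation.pos_iff _).mpr hdx0
    rw [map_div₀, one_lt_div₀ hdxpos]
    by_contra hle
    rw [not_lt] at hle
    -- the exact Taylor expansion, with `F_y(P) = s - Δy`
    have hT : Fx * (x₂ - x₁) = -(s * (y₂ - y₁)) - W.a₁ * (x₂ - x₁) * (y₂ - y₁)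
        + (3 * x₁ + W.a₂) * (x₂ - x₁) ^ 2 + (x₂ - x₁) ^ 3 := by
      rw [equation_iff] at h₁ h₂
      rw [hFx, hs_def, negY]
      linear_combination h₂ - h₁
    have hdx1 : w (x₂ - x₁) ≤ 1 := w.map_sub_le hx₂ hx₁
    have h3 : w (3 * x₁ + W.a₂) ≤ 1 := by
      have e3 : (3 : F) * x₁ + W.a₂ = x₁ + x₁ + x₁ + W.a₂ := by ring
      rw [e3]
      exact w.map_add_le (w.map_add_le (w.map_add_le hx₁ hx₁) hx₁) ha₂
    have hbound : w (Fx * (x₂ - x₁)) < w (x₂ - x₁) * δ := by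
      rw [hT]
      refine w.map_add_lt (w.map_add_lt (w.map_sub_lt ?_ ?_) ?_) ?_
      · rw [Valuation.map_neg, map_mul]
        calc w s * w (y₂ - y₁) ≤ w (x₂ - x₁) * w (y₂ - y₁) := mul_le_mul_left hle _
          _ < w (x₂ - x₁) * δ := mul_lt_mul_of_pos_left hdy hdxpos
      · rw [map_mul, map_mul]
        calc w W.a₁ * w (x₂ - x₁) * w (y₂ - y₁) ≤ w (x₂ - x₁) * w (y₂ - y₁) :=
            mul_le_mul_left (mul_le_of_le_one_left' ha₁) _
          _ < w (x₂ - x₁) * δ := mul_lt_mul_of_pos_left hdy hdxpos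
      · rw [map_mul, map_pow, sq]
        calc w (3 * x₁ + W.a₂) * (w (x₂ - x₁) * w (x₂ - x₁)) ≤ w (x₂ - x₁) * w (x₂ - x₁) :=
            mul_le_of_le_one_left' h3
          _ < w (x₂ - x₁) * δ := mul_lt_mul_of_pos_left hdx hdxpos
      · rw [map_pow, pow_succ, sq]
        calc w (x₂ - x₁) * w (x₂ - x₁) * w (x₂ - x₁) ≤ w (x₂ - x₁) * w (x₂ - x₁) :=
            mul_le_of_le_one_right' hdx1
          _ < w (x₂ - x₁) * δ := mul_lt_mul_of_pos_left hdx hdxpos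
    have hFx_lt : w Fx < δ := by
      by_contra hge
      rw [not_lt] at hge
      have : w (x₂ - x₁) * δ ≤ w (Fx * (x₂ - x₁)) := by
        rw [map_mul, mul_comm]
        exact mul_le_mul_left hge _
      exact absurd hbound (not_lt.mpr this)
    have hFy_lt : w Fy < δ := by
      have e : Fy = s - (y₂ - y₁) := by rw [hs]; ring
      rw [e]
      exact w.map_sub_lt (lt_of_le_of_lt hle hdx) hdy
    exact absurd hδ (not_le.mpr (max_lt hFx_lt hFy_lt))

end Valuation

end Affine

/-! ### Compactness: finitely many neighbourhoods cover the integral points -/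

section Cover

variable {L : Type*} [Field L] {Γ₀ : Type*} [LinearOrderedCommGroupWithZero Γ₀] [Valued L Γ₀]

/-- **Finitely many small boxes cover the integral points** (Silverman, *AEC*, Exercise 7.6
(a),(b), PDF p. 181: `E(K)` is compact). Let `L` be a valued field whose valuation ring
`{|x| ≤ 1}` is compact and `M` an elliptic curve over `L`. There is a finite set `t` of integral
solutions `p = (x₁, y₁)` of the Weierstrass equation such that every integral solution `(x, y)`
satisfies `|x - x₁| < δ_p` and `|y - y₁| < δ_p` for some `p ∈ t`, where
`δ_p = max (|F_x(p)|, |F_y(p)|) ≠ 0` (`p` is nonsingular). Proof: the integral solutions form a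
closed subset of the compact `{|x| ≤ 1}²`, and the boxes are neighbourhoods
(`IsCompact.elim_nhds_subcover`). [cite: SilvermanAEC2009, Exercise 7.6 (a),(b) (PDF p. 181)] -/
theorem exists_finset_integralPoints_near (hO : IsCompact {x : L | Valued.v x ≤ 1})
    (M : WeierstrassCurve L) [M.IsElliptic] :
    ∃ t : Finset (L × L),
      (∀ p ∈ t, Valued.v p.1 ≤ 1 ∧ Valued.v p.2 ≤ 1 ∧ M.toAffine.Equation p.1 p.2) ∧
      ∀ x y : L, Valued.v x ≤ 1 → Valued.v y ≤ 1 → M.toAffine.Equation x y →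
        ∃ p ∈ t,
          Valued.v (x - p.1) < max (Valued.v (M.a₁ * p.2 - (3 * p.1 ^ 2 + 2 * M.a₂ * p.1 + M.a₄)))
              (Valued.v (2 * p.2 + M.a₁ * p.1 + M.a₃)) ∧
          Valued.v (y - p.2) < max (Valued.v (M.a₁ * p.2 - (3 * p.1 ^ 2 + 2 * M.a₂ * p.1 + M.a₄)))
              (Valued.v (2 * p.2 + M.a₁ * p.1 + M.a₃)) := by
  -- the compact set of integral solutions
  set Z : Set (L × L) := ({x : L | Valued.v x ≤ 1} ×ˢ {x : L | Valued.v x ≤ 1}) ∩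
    {p : L × L | M.toAffine.Equation p.1 p.2} with hZ
  have hcl : IsClosed {p : L × L | M.toAffine.Equation p.1 p.2} := by
    have hG : Continuous fun p : L × L =>
        p.2 ^ 2 + M.a₁ * p.1 * p.2 + M.a₃ * p.2 - (p.1 ^ 3 + M.a₂ * p.1 ^ 2 + M.a₄ * p.1 + M.a₆) := by
      fun_prop
    convert isClosed_eq hG (continuous_const (y := (0 : L))) using 1
    ext p
    exact Affine.equation_iff' p.1 p.2
  have hZc : IsCompact Z := (hO.prod hO).inter_right hcl
  -- the boxes
  set δ : L × L → Γ₀ := fun p =>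
    max (Valued.v (M.a₁ * p.2 - (3 * p.1 ^ 2 + 2 * M.a₂ * p.1 + M.a₄)))
      (Valued.v (2 * p.2 + M.a₁ * p.1 + M.a₃)) with hδ
  set U : L × L → Set (L × L) := fun p =>
    {q | Valued.v (q.1 - p.1) < δ p ∧ Valued.v (q.2 - p.2) < δ p} with hU
  have hUn : ∀ p ∈ Z, U p ∈ 𝓝 p := by
    rintro ⟨x₁, y₁⟩ ⟨-, heq⟩
    have hns : M.toAffine.Nonsingular x₁ y₁ := Affine.equation_iff_nonsingular.mp heq
    rw [Affine.nonsingular_iff'] at hns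
    -- the radius `δ` is the valuation of a non-zero element
    obtain ⟨c, hc0, hc⟩ : ∃ c : L, Valued.v c ≠ 0 ∧ Valued.v c = δ (x₁, y₁) := by
      rcases le_total (Valued.v (2 * y₁ + M.a₁ * x₁ + M.a₃))
          (Valued.v (M.a₁ * y₁ - (3 * x₁ ^ 2 + 2 * M.a₂ * x₁ + M.a₄))) with h | h
      · refine ⟨_, fun h0 => ?_, (max_eq_left h).symm⟩
        rcases hns.2 with h' | h'
        · exact h' ((Valuation.zero_iff _).mp h0)
        · exact h' ((Valuation.zero_iff _).mp (le_antisymm (h0 ▸ h) zero_le))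
      · refine ⟨_, fun h0 => ?_, (max_eq_right h).symm⟩
        rcases hns.2 with h' | h'
        · exact h' ((Valuation.zero_iff _).mp (le_antisymm (h0 ▸ h) zero_le))
        · exact h' ((Valuation.zero_iff _).mp h0)
    have hball : ∀ a : L, {b : L | Valued.v (b - a) < Valued.v c} ∈ 𝓝 a := fun a =>
      Literature.NumberTheory.EllipticCurves.valued_ball_mem_nhds a hc0
    refine Filter.mem_of_superset (prod_mem_nhds (hball x₁) (hball y₁)) ?_
    rintro ⟨a, b⟩ ⟨ha, hb⟩
    simp only [Set.mem_setOf_eq] at ha hb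
    rw [hc] at ha hb
    exact ⟨ha, hb⟩
  obtain ⟨t, htZ, hcov⟩ := hZc.elim_nhds_subcover U hUn
  refine ⟨t, fun p hp => ?_, fun x y hx hy hxy => ?_⟩
  · obtain ⟨⟨h1, h2⟩, h3⟩ := htZ p hp
    exact ⟨h1, h2, h3⟩
  · have hmem : (x, y) ∈ Z := ⟨⟨hx, hy⟩, hxy⟩
    obtain ⟨p, hp, hpU⟩ := Set.mem_iUnion₂.mp (hcov hmem)
    exact ⟨p, hp, hpU.1, hpU.2⟩

end Cover

/-! ### `E(K_v)/E₀(K_v)` is finite -/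

section AdicCompletion

open IsDedekindDomain

variable {A : Type*} [CommRing A] [IsDedekindDomain A] {K : Type*} [Field K] [Algebra A K]
  [IsFractionRing A K] (v : HeightOneSpectrum A)

/-- **Silverman, *AEC* Cor. VII.6.2 / Exercise 7.6 (d): `E(K_v)/E₀(K_v)` is finite.** For a
minimal Weierstrass equation `M` of an elliptic curve over the completion `K_v` of the fraction
field of a Dedekind domain at a finite place `v` with compact valuation ring `O_v` (e.g. a number
field), the subgroup `E₀(K_v) = M.goodReductionSubgroup O_v` generated by the points with
nonsingular reduction has finite index. Proof: every point is congruent modulo `E₀` to `𝒪` or to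
one of the finitely many integral points of `exists_finset_integralPoints_near` — a non-integral
point lies in `E₀`, and an integral point `Q` in the box of `P` has `Q - P` non-integral
(`Affine.one_lt_valuation_addX_of_near`), hence in `E₀`.
[cite: SilvermanAEC2009, Cor. VII.6.2 (PDF p. 177) with Exercise 7.6 (PDF p. 181)] -/
theorem finite_quotient_goodReductionSubgroup [CompactSpace (v.adicCompletionIntegers K)]
    (M : WeierstrassCurve (v.adicCompletion K)) [M.IsMinimal (v.adicCompletionIntegers K)]
    [M.IsElliptic] :
    Finite (M.toAffine.Point ⧸ M.goodReductionSubgroup (v.adicCompletionIntegers K)) := by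
  -- integrality of the coefficients
  have hle : ∀ {a : v.adicCompletion K},
      a ∈ (algebraMap (v.adicCompletionIntegers K) (v.adicCompletion K)).range →
        Valued.v a ≤ 1 := by
    rintro a ⟨r, rfl⟩
    exact (HeightOneSpectrum.mem_adicCompletionIntegers A K v).mp r.2
  obtain ⟨h₁, h₂, h₃, h₄, h₆⟩ :=
    (isIntegral_iff_forall_mem_range (R := v.adicCompletionIntegers K) M).mp inferInstance
  have ha₁ := hle h₁
  have ha₂ := hle h₂
  have ha₃ := hle h₃
  have ha₄ := hle h₄
  have ha₆ := hle h₆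
  -- compactness of `O_v`
  have hO : IsCompact {x : v.adicCompletion K | Valued.v x ≤ 1} := by
    have e : {x : v.adicCompletion K | Valued.v x ≤ 1} =
        (v.adicCompletionIntegers K : Set (v.adicCompletion K)) := by
      ext x
      exact (HeightOneSpectrum.mem_adicCompletionIntegers A K v).symm
    rw [e]
    exact isCompact_iff_compactSpace.mpr inferInstance
  obtain ⟨t, ht, hcov⟩ := exists_finset_integralPoints_near hO M
  set E₀ := M.goodReductionSubgroup (v.adicCompletionIntegers K) with hE₀
  -- non-integral points lie in `E₀`
  have hE₁ : ∀ {x y : v.adicCompletion K} (h : M.toAffine.Nonsingular x y), 1 < Valued.v x →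
      (Affine.Point.some x y h : M.toAffine.Point) ∈ E₀ := by
    intro x y h hx
    refine AddSubgroup.subset_closure (Or.inl ?_)
    rintro ⟨r, hr⟩
    have hr1 := (HeightOneSpectrum.mem_adicCompletionIntegers A K v).mp r.2
    rw [← hr] at hx
    exact absurd hr1 (not_le.mpr hx)
  -- the finitely many cosets
  let f : Option t → M.toAffine.Point ⧸ E₀ := fun o =>
    match o with
    | none => 0
    | some p => if h : M.toAffine.Nonsingular p.1.1 p.1.2 then
        (QuotientAddGroup.mk (Affine.Point.some _ _ h) : M.toAffine.Point ⧸ E₀) else 0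
  refine Finite.of_surjective f fun q => ?_
  induction q using QuotientAddGroup.induction_on with
  | H P => ?_
  rcases P with _ | ⟨x, y, hP⟩
  · exact ⟨none, rfl⟩
  · by_cases hx : Valued.v x ≤ 1
    · have hy : Valued.v y ≤ 1 :=
        Affine.valuation_y_le_one Valued.v ha₁ ha₂ ha₃ ha₄ ha₆ hP.left hx
      obtain ⟨p, hp, hdx, hdy⟩ := hcov x y hx hy hP.left
      obtain ⟨hp1, -, hpeq⟩ := ht p hp
      have hpns : M.toAffine.Nonsingular p.1 p.2 := Affine.equation_iff_nonsingular.mp hpeq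
      refine ⟨some ⟨p, hp⟩, ?_⟩
      simp only [f, dif_pos hpns]
      by_cases hne : x = p.1 ∧ y = p.2
      · obtain ⟨rfl, rfl⟩ := hne
        rfl
      · have key := Affine.one_lt_valuation_addX_of_near Valued.v ha₁ ha₂ hpeq hP.left hp1 hx
          le_rfl hdx hdy hne
        refine (QuotientAddGroup.eq_iff_sub_mem.mpr ?_).symm
        rw [sub_eq_add_neg, Affine.Point.neg_some,
          Affine.Point.add_some fun h => hne ⟨h.1, h.2.trans (Affine.negY_negY _ _)⟩]
        exact hE₁ _ key
    · exact ⟨none, ((QuotientAddGroup.eq_zero_iff _).mpr (hE₁ hP (not_le.mp hx))).symm⟩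

/-- **`c_v ≠ 0`: `E₀(K_v)` has finite index** (Silverman, *AEC*, Cor. VII.6.2), for every
Weierstrass equation `X` of an elliptic curve over a completion `K_v` with compact `O_v`: the local
Tamagawa number `[E(K_v) : E₀(K_v)]`, computed on the `O_v`-minimal model `X.minimal O_v`
(again elliptic), is the index of a subgroup with finite quotient
(`finite_quotient_goodReductionSubgroup`). [cite: SilvermanAEC2009, Cor. VII.6.2 (PDF p. 177)] -/
theorem localTamagawaNumber_ne_zero_of_compactSpace [CompactSpace (v.adicCompletionIntegers K)]
    (X : WeierstrassCurve (v.adicCompletion K)) [X.IsElliptic] :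
    X.localTamagawaNumber (v.adicCompletionIntegers K) ≠ 0 := by
  haveI : (X.minimal (v.adicCompletionIntegers K)).IsElliptic := by
    unfold minimal; infer_instance
  haveI := finite_quotient_goodReductionSubgroup v (X.minimal (v.adicCompletionIntegers K))
  exact AddSubgroup.index_ne_zero_of_finite

end AdicCompletion

/-! ### Number fields: discharge of `tamagawaProduct_pos` -/

section NumberField

open IsDedekindDomain NumberField

variable {K : Type*} [Field K] [NumberField K] (W : WeierstrassCurve K)

/-- **`c_v = [E(K_v) : E₀(K_v)] ≠ 0` at every finite place of a number field** (Silverman,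
*AEC*, Cor. VII.6.2): the local factor of `tamagawaProduct` at `v` is a genuine finite index.
The valuation ring `O_v` of a number field is compact
(`Literature.NumberTheory.Automorphic.compactSpace_adicCompletionIntegers'`, Weil, *BNT*, Ch. I §4), so
`localTamagawaNumber_ne_zero_of_compactSpace` applies to `W ⊗ K_v`.
[cite: SilvermanAEC2009, Cor. VII.6.2 (PDF p. 177)] -/
theorem localTamagawaNumber_baseChange_ne_zero [W.IsElliptic] (v : HeightOneSpectrum (𝓞 K)) :
    (W.baseChange (v.adicCompletion K)).localTamagawaNumber (v.adicCompletionIntegers K) ≠ 0 := by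
  haveI := Literature.NumberTheory.Automorphic.compactSpace_adicCompletionIntegers' K v
  haveI : (W.baseChange (v.adicCompletion K)).IsElliptic := by
    rw [baseChange]; infer_instance
  exact localTamagawaNumber_ne_zero_of_compactSpace v _

/-- **Discharge of the named fact `WeierstrassCurve.tamagawaProduct_pos`** (`Tamagawa.lean`):
the Tamagawa product `∏ᶠ_v c_v` of an elliptic curve over a number field is a positive integer,
every factor `c_v = [E(K_v) : E₀(K_v)]` being a finite index, hence `≥ 1` (Silverman, *AEC*,
Cor. VII.6.2; Wiles, Clay BSD text, §1); `finprod_induction` on positivity. (If infinitely many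
factors differed from `1` the `finprod` would be its junk value `1 > 0`; that this does not happen
is the separate fact `mulSupport_localTamagawaNumber_finite`, not needed here.)
[cite: SilvermanAEC2009, Cor. VII.6.2 (PDF p. 177)] -/
theorem tamagawaProduct_pos_holds : W.tamagawaProduct_pos := by
  intro _
  exact finprod_induction (fun n : ℕ => 0 < n) Nat.one_pos (fun _ _ => Nat.mul_pos) fun v =>
    Nat.pos_of_ne_zero (W.localTamagawaNumber_baseChange_ne_zero v)

/-- The Tamagawa product of an elliptic curve over a number field is positive (instance-argument
form of `tamagawaProduct_pos_holds`). [cite: SilvermanAEC2009, Cor. VII.6.2 (PDF p. 177)] -/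
theorem tamagawaProduct_pos' [W.IsElliptic] : 0 < W.tamagawaProduct :=
  W.tamagawaProduct_pos_holds

end NumberField

end WeierstrassCurve

end
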